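import Mathlib
import HarnessLib
import Summits.AtomisticToContinuum.Statement
import Literature.Geometry.DiscreteGeometry.KissingPatterns
import Literature.Probability.Process.PointStationaryLaw
import Literature.MathematicalPhysics.StatisticalMechanics.RootEnergy
import Summits.AtomisticToContinuum.Crystallization.Theses.FrustratedLawDichotomy
import Summits.AtomisticToContinuum.Crystallization.Theses.PalmUnimodularRigidity
import Summits.AtomisticToContinuum.Crystallization.Theorems.PalmUnimodularRigidityBenjaminiSchrammLimitEnergy

/-!
# Ergodic reduction for the crux `AperiodicFrustratedLawGap` — transfer along a decomposition

Route `FrustratedLawDichotomy`, crux `AperiodicFrustratedLawGap` (item `stmt-AtomisticToContinuum-27623`),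
registered stub `stub_ergodicReduction` (`S_ergodicReduction`, skeleton `dd3251ad731e`): *if an aperiodic
texture-charging Nash hard-core point-stationary law has mean root energy `≤ e⋆`, then so does an ERGODIC one*.

This file proves the BOOKKEEPING HALF of that stub, sorry-free, and isolates the remaining content as ONE
explicit hypothesis.

* `isPointStationaryLaw_restrict_of_ae_invariant`, `isPointStationaryLaw_restrict_of_invariant` —
  restricting a point-stationary law to a re-rooting-invariant event keeps the Mecke identity (step one
  of every decomposition argument).
* `exists_of_join` — **transfer along a decomposition.**  Let `P` be a probability law on configurations
  of `ℝ³`, almost surely rooted `δ`-hard-core, with mean root energy `≤ e⋆`, and let `P = join m` be ANY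
  representation of `P` as a mixture of probability laws which are almost all point-stationary.  Then
  `m`-almost every component inherits every `P`-almost-sure property and every `P`-null set
  (`Measure.ae_ae_of_ae_join`), and — because every point-stationary hard-core law has mean root energy
  `≥ e⋆` (item 9229 `UnimodularEnergyLowerBound`, PROVED in the tree by
  `Summit.AtomisticToContinuum.Crystallization.Theorems.unimodularEnergyLowerBound_proof`; taken here as
  the hypothesis `hLB` in the route's own vocabulary because that module is not importable on the farm at
  the time of writing) while the `m`-average of the components' means is the mean of `P`
  (`Measure.lintegral_join` on a clamped Giry-measurable root energy) — `m`-almost every component has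
  mean root energy `≤ e⋆` too.  So a component with all these properties EXISTS; if the components are
  almost all ergodic, it is ergodic.
* `ergodicReduction_of_decomposition` — the registered stub statement `S_ergodicReduction` VERBATIM, from
  `hLB` and the single remaining input `hdec`: the **ergodic decomposition of point-stationary hard-core
  laws** (every point-stationary probability law on rooted `δ`-hard-core configurations is a mixture
  `join m` of point-stationary probability laws almost all of which are trivial on the measurable
  re-rooting-invariant sets) — the Palm / mass-transport form of the Krylov–Bogolyubov–Farrell–Varadarajan
  ergodic decomposition (Kallenberg, *Foundations of Modern Probability* (3rd ed.) Prop. 10.24 /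
  Thm 10.26 for measurable groups of transformations; Aldous–Lyons 2007 §4 for unimodular measures).  It
  is NOT in the tree or in Mathlib (it needs regular conditional laws on the compact configuration space
  `RootedHardCoreConfig` and an ergodic theorem for point-stationary laws, or Choquet theory); it is the
  exact remaining lemma of the stub.

All statements are `[folklore]` bookkeeping.
-/

noncomputable section

namespace Summit.AtomisticToContinuum.Crystallization.Theorems.FrustratedLawDichotomyErgodicReduction

open MeasureTheory Set Filter
open scoped ENNReal
open Literature.MathematicalPhysics.StatisticalMechanics (lennardJones rootEnergy PeriodicConfiguration)
open Literature.Probability.Process (IsRootedHardCore IsPointStationaryLaw LocalConfig)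
open Literature.Probability.Process.LocalConfig (RootedHardCoreConfig toMeasure_def)
open Summit.AtomisticToContinuum.Crystallization.Theses.PalmUnimodularRigidity (UnimodularEnergyLowerBound)
open Summit.AtomisticToContinuum.Crystallization.Theorems.BenjaminiSchrammLimit (sum_abs_lennardJones_le
  lintegral_toMeasure_le_of_forall_finset integrable_lennardJones_toMeasure measurable_lennardJones_norm)

/-! ### Restriction of a point-stationary law to an invariant event -/

/-- **Restriction to an invariant event.**  If `P` is a point-stationary law (Mecke / mass-transport
identity) on configurations in a measurable additive group and `A` is a measurable set of configurations
which is almost surely invariant under re-rooting at almost every point of the configuration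
(`μ ∈ A ↔ θ_y μ ∈ A` for `P`-a.e. `μ` and `μ`-a.e. `y`), then the restricted law `P|_A` is again
point-stationary: test the identity of `P` with `1_A(μ) g(μ, y)` and move the indicator through the
re-rooting.  This is the first step of the ergodic decomposition (conditioning on invariant events keeps
unimodularity; Aldous–Lyons 2007 §4). [folklore] -/
theorem isPointStationaryLaw_restrict_of_ae_invariant {G : Type*} [MeasurableSpace G] [AddGroup G]
    {P : Measure (Measure G)} (hP : IsPointStationaryLaw P) {A : Set (Measure G)}
    (hA : MeasurableSet A)
    (hinv : ∀ᵐ μ ∂P, ∀ᵐ y ∂μ, (μ ∈ A ↔ Measure.map (fun z => z - y) μ ∈ A)) :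
    IsPointStationaryLaw (P.restrict A) := by
  classical
  intro g hg
  -- the tested function `1_A(μ) · g(μ, y)`
  set g' : Measure G → G → ℝ≥0∞ := fun μ y => A.indicator (fun _ => (1 : ℝ≥0∞)) μ * g μ y
    with hg'_def
  have hg' : Measurable (Function.uncurry g') :=
    ((measurable_const.indicator hA).comp measurable_fst).mul hg
  have hind : ∀ (μ : Measure G) (F : Measure G → ℝ≥0∞),
      A.indicator (fun _ => (1 : ℝ≥0∞)) μ * F μ = A.indicator F μ := fun μ F => by
    by_cases hμ : μ ∈ A
    · rw [indicator_of_mem hμ, indicator_of_mem hμ, one_mul]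
    · rw [indicator_of_notMem hμ, indicator_of_notMem hμ, zero_mul]
  have hne : ∀ μ : Measure G, A.indicator (fun _ => (1 : ℝ≥0∞)) μ ≠ ∞ := fun μ => by
    by_cases hμ : μ ∈ A
    · rw [indicator_of_mem hμ]; exact ENNReal.one_ne_top
    · rw [indicator_of_notMem hμ]; exact ENNReal.zero_ne_top
  have key := hP g' hg'
  -- left-hand side
  have hL : ∫⁻ μ, ∫⁻ y, g' μ y ∂μ ∂P = ∫⁻ μ in A, ∫⁻ y, g μ y ∂μ ∂P := by
    rw [← lintegral_indicator hA]
    refine lintegral_congr fun μ => ?_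
    rw [← hind μ (fun μ => ∫⁻ y, g μ y ∂μ)]
    exact lintegral_const_mul' _ _ (hne μ)
  -- right-hand side
  have hR : ∫⁻ μ, ∫⁻ y, g' (Measure.map (fun z => z - y) μ) (-y) ∂μ ∂P =
      ∫⁻ μ in A, ∫⁻ y, g (Measure.map (fun z => z - y) μ) (-y) ∂μ ∂P := by
    rw [← lintegral_indicator hA]
    refine lintegral_congr_ae (hinv.mono fun μ hμ => ?_)
    rw [← hind μ (fun μ => ∫⁻ y, g (Measure.map (fun z => z - y) μ) (-y) ∂μ),
      ← lintegral_const_mul' _ _ (hne μ)]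
    refine lintegral_congr_ae (hμ.mono fun y hy => ?_)
    simp only [hg'_def]
    congr 1
    by_cases hμA : μ ∈ A
    · rw [indicator_of_mem hμA, indicator_of_mem (hy.1 hμA)]
    · rw [indicator_of_notMem hμA, indicator_of_notMem (fun h => hμA (hy.2 h))]
  rw [hL, hR] at key
  exact key

/-- **Restriction to a re-rooting-invariant event, hard-core laws.**  For a point-stationary law `P`
carried by rooted `δ`-hard-core configurations of `ℝ³` (`δ > 0`) and a measurable set `A` of
configurations invariant under re-rooting at atoms (`μ {p} ≠ 0 → (μ ∈ A ↔ θ_p μ ∈ A)`), the restricted law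
`P|_A` is point-stationary (every point of a counting measure is an atom). [folklore] -/
theorem isPointStationaryLaw_restrict_of_invariant {δ : ℝ} (hδ : 0 < δ) {P : Measure (Measure (EuclideanSpace ℝ (Fin 3)))}
    (hP : IsPointStationaryLaw P) (hcore : ∀ᵐ μ ∂P, IsRootedHardCore δ μ) {A : Set (Measure (EuclideanSpace ℝ (Fin 3)))}
    (hA : MeasurableSet A)
    (hinv : ∀ μ : Measure (EuclideanSpace ℝ (Fin 3)), ∀ p : (EuclideanSpace ℝ (Fin 3)), μ {p} ≠ 0 →
      (μ ∈ A ↔ Measure.map (fun z : (EuclideanSpace ℝ (Fin 3)) => z - p) μ ∈ A)) :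
    IsPointStationaryLaw (P.restrict A) := by
  refine isPointStationaryLaw_restrict_of_ae_invariant hP hA (hcore.mono fun μ hμ => ?_)
  obtain ⟨S, -, hsep, rfl⟩ := hμ
  have hSm : MeasurableSet S :=
    (Metric.isClosed_of_pairwise_le_dist hδ fun x hx y hy hxy => hsep x hx y hy hxy).measurableSet
  have hS : ∀ᵐ y ∂((Measure.count : Measure (EuclideanSpace ℝ (Fin 3))).restrict S), y ∈ S := ae_restrict_mem hSm
  refine hS.mono fun y hy => hinv _ y ?_
  rw [Measure.restrict_apply (measurableSet_singleton y),
    inter_eq_left.2 (singleton_subset_iff.2 hy), Measure.count_singleton]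
  exact one_ne_zero

/-! ### A clamped, Giry-measurable, bounded root energy -/

/-- **The root energy through positive and negative parts.**  On a rooted `δ`-hard-core configuration
(`δ > 0`) the Bochner root energy `½ ∫ V_LJ(‖y‖) dμ` is `½ ((∫⁻ V_LJ⁺).toReal - (∫⁻ V_LJ⁻).toReal)`, both
`lintegral`s being bounded by the absolute-convergence constant of
`BenjaminiSchrammLimit.sum_abs_lennardJones_le`. [folklore] -/
theorem rootEnergy_eq_toReal_sub_toReal {δ : ℝ} (hδ : 0 < δ) {μ : Measure (EuclideanSpace ℝ (Fin 3))}
    (hμ : IsRootedHardCore δ μ) :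
    rootEnergy lennardJones μ = ((∫⁻ y, ENNReal.ofReal (lennardJones ‖y‖) ∂μ).toReal -
      (∫⁻ y, ENNReal.ofReal (-lennardJones ‖y‖) ∂μ).toReal) / 2 ∧
    ∫⁻ y, ENNReal.ofReal (lennardJones ‖y‖) ∂μ ≤
      ENNReal.ofReal (250 * (((1 / 12) * δ⁻¹ ^ 7 + (1 / 6) * δ⁻¹) * δ⁻¹ ^ 5)) ∧
    ∫⁻ y, ENNReal.ofReal (-lennardJones ‖y‖) ∂μ ≤
      ENNReal.ofReal (250 * (((1 / 12) * δ⁻¹ ^ 7 + (1 / 6) * δ⁻¹) * δ⁻¹ ^ 5)) := by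
  obtain ⟨S, h0, hsep, rfl⟩ := hμ
  -- the configuration as a point of the compact configuration space
  set S' : RootedHardCoreConfig (EuclideanSpace ℝ (Fin 3)) δ := ⟨LocalConfig.mk S, h0, hsep⟩ with hS'_def
  have hSμ : ((S'.1 : LocalConfig (EuclideanSpace ℝ (Fin 3)))).toMeasure = (Measure.count : Measure (EuclideanSpace ℝ (Fin 3))).restrict S := rfl
  have hbound : ∀ (g : ℝ → ℝ), (∀ t, g t ≤ |t|) →
      ∫⁻ y, ENNReal.ofReal (g (lennardJones ‖y‖)) ∂((Measure.count : Measure (EuclideanSpace ℝ (Fin 3))).restrict S) ≤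
        ENNReal.ofReal (250 * (((1 / 12) * δ⁻¹ ^ 7 + (1 / 6) * δ⁻¹) * δ⁻¹ ^ 5)) := by
    intro g hg
    rw [← hSμ]
    refine lintegral_toMeasure_le_of_forall_finset hδ S' fun T hT => ?_
    calc ∑ y ∈ T, ENNReal.ofReal (g (lennardJones ‖y‖))
        ≤ ∑ y ∈ T, ENNReal.ofReal (|lennardJones ‖y‖|) :=
          Finset.sum_le_sum fun y _ => ENNReal.ofReal_le_ofReal (hg _)
      _ = ENNReal.ofReal (∑ y ∈ T, |lennardJones ‖y‖|) :=
          (ENNReal.ofReal_sum_of_nonneg fun y _ => abs_nonneg _).symm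
      _ ≤ _ := ENNReal.ofReal_le_ofReal (sum_abs_lennardJones_le hδ S' T hT)
  refine ⟨?_, hbound (fun t => t) fun t => le_abs_self t, hbound (fun t => -t) fun t => neg_le_abs t⟩
  have hint : Integrable (fun y : (EuclideanSpace ℝ (Fin 3)) => lennardJones ‖y‖) ((Measure.count : Measure (EuclideanSpace ℝ (Fin 3))).restrict S) := by
    rw [← hSμ]; exact integrable_lennardJones_toMeasure hδ S'
  show (∫ y, lennardJones ‖y‖ ∂((Measure.count : Measure (EuclideanSpace ℝ (Fin 3))).restrict S)) / 2 = _
  rw [integral_eq_lintegral_pos_part_sub_lintegral_neg_part hint]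

/-- **Clamped measurable root energy.** For `δ > 0` there are a bound `B ≥ 0` and a Giry-measurable
function `G` on configurations with `|G| ≤ B` everywhere, equal to the Bochner root energy
`rootEnergy lennardJones` on every rooted `δ`-hard-core configuration (clamp the measurable
positive/negative-part expression to its a-priori hard-core bounds). [folklore] -/
theorem exists_measurable_bounded_rootEnergy {δ : ℝ} (hδ : 0 < δ) :
    ∃ B : ℝ, 0 ≤ B ∧ ∃ G : Measure (EuclideanSpace ℝ (Fin 3)) → ℝ, Measurable G ∧ (∀ μ, |G μ| ≤ B) ∧
      ∀ μ, IsRootedHardCore δ μ → G μ = rootEnergy lennardJones μ := by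
  set B : ℝ := 250 * (((1 / 12) * δ⁻¹ ^ 7 + (1 / 6) * δ⁻¹) * δ⁻¹ ^ 5) with hB_def
  have hB : 0 ≤ B := by positivity
  set G₀ : Measure (EuclideanSpace ℝ (Fin 3)) → ℝ := fun μ => ((∫⁻ y, ENNReal.ofReal (lennardJones ‖y‖) ∂μ).toReal -
      (∫⁻ y, ENNReal.ofReal (-lennardJones ‖y‖) ∂μ).toReal) / 2 with hG₀_def
  have hmp : Measurable fun y : (EuclideanSpace ℝ (Fin 3)) => ENNReal.ofReal (lennardJones ‖y‖) :=
    ENNReal.measurable_ofReal.comp measurable_lennardJones_norm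
  have hmm : Measurable fun y : (EuclideanSpace ℝ (Fin 3)) => ENNReal.ofReal (-lennardJones ‖y‖) :=
    ENNReal.measurable_ofReal.comp measurable_lennardJones_norm.neg
  have hG₀ : Measurable G₀ :=
    ((ENNReal.measurable_toReal.comp (Measure.measurable_lintegral hmp)).sub
      (ENNReal.measurable_toReal.comp (Measure.measurable_lintegral hmm))).div_const 2
  refine ⟨B, hB, fun μ => max (min (G₀ μ) B) (-B), ?_, ?_, ?_⟩
  · exact (hG₀.min measurable_const).max measurable_const
  · intro μ
    rw [abs_le]
    exact ⟨le_max_right _ _, max_le (min_le_right _ _) (by linarith)⟩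
  · intro μ hμ
    obtain ⟨heq, hp, hm⟩ := rootEnergy_eq_toReal_sub_toReal hδ hμ
    have hp' : (∫⁻ y, ENNReal.ofReal (lennardJones ‖y‖) ∂μ).toReal ≤ B :=
      ENNReal.toReal_le_of_le_ofReal hB hp
    have hm' : (∫⁻ y, ENNReal.ofReal (-lennardJones ‖y‖) ∂μ).toReal ≤ B :=
      ENNReal.toReal_le_of_le_ofReal hB hm
    have hp0 : 0 ≤ (∫⁻ y, ENNReal.ofReal (lennardJones ‖y‖) ∂μ).toReal := ENNReal.toReal_nonneg
    have hm0 : 0 ≤ (∫⁻ y, ENNReal.ofReal (-lennardJones ‖y‖) ∂μ).toReal := ENNReal.toReal_nonneg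
    have h1 : G₀ μ ≤ B := by simp only [hG₀_def]; linarith
    have h2 : -B ≤ G₀ μ := by simp only [hG₀_def]; linarith
    show max (min (G₀ μ) B) (-B) = _
    rw [min_eq_left h1, max_eq_left h2, heq]

/-- The integral of a bounded measurable real function against a probability measure, through the
`lintegral` of its nonnegative shift: `∫ G dQ = (∫⁻ ofReal (G + B) dQ).toReal - B`. [folklore] -/
theorem integral_eq_toReal_lintegral_sub {α : Type*} [MeasurableSpace α] {Q : Measure α}
    [IsProbabilityMeasure Q] {G : α → ℝ} (hG : Measurable G) {B : ℝ} (hGB : ∀ x, |G x| ≤ B) :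
    ∫ x, G x ∂Q = (∫⁻ x, ENNReal.ofReal (G x + B) ∂Q).toReal - B := by
  have hint : Integrable G Q := Integrable.of_bound hG.aestronglyMeasurable B
    (Eventually.of_forall fun x => by rw [Real.norm_eq_abs]; exact hGB x)
  have h1 : ∫ x, (G x + B) ∂Q = ∫ x, G x ∂Q + B := by
    rw [integral_add hint (integrable_const B), integral_const, smul_eq_mul, probReal_univ, one_mul]
  have h2 : ∫ x, (G x + B) ∂Q = (∫⁻ x, ENNReal.ofReal (G x + B) ∂Q).toReal :=
    integral_eq_lintegral_of_nonneg_ae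
      (Eventually.of_forall fun x => by
        have := hGB x; rw [abs_le] at this; simp only [Pi.zero_apply]; linarith)
      (hG.add_const B).aestronglyMeasurable
  linarith

/-- The `lintegral` of the nonnegative shift of a function bounded by `B` against a probability measure is
at most `2B`, in particular finite. [folklore] -/
theorem lintegral_ofReal_add_le {α : Type*} [MeasurableSpace α] {Q : Measure α}
    [IsProbabilityMeasure Q] {G : α → ℝ} {B : ℝ} (hGB : ∀ x, |G x| ≤ B) :
    ∫⁻ x, ENNReal.ofReal (G x + B) ∂Q ≤ ENNReal.ofReal (2 * B) := by
  calc ∫⁻ x, ENNReal.ofReal (G x + B) ∂Q ≤ ∫⁻ _, ENNReal.ofReal (2 * B) ∂Q :=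
        lintegral_mono fun x => ENNReal.ofReal_le_ofReal
          (by have := hGB x; rw [abs_le] at this; linarith)
    _ = ENNReal.ofReal (2 * B) := by rw [lintegral_const, measure_univ, mul_one]

/-! ### Transfer along a decomposition `P = join m` -/

/-- **Transfer along a decomposition.**  Let `δ > 0` and let `P` be a probability law on configurations of
`ℝ³` which is almost surely rooted `δ`-hard-core, satisfies two further almost-sure properties `p₁`, `p₂`
and gives zero (outer) measure to a set `S₃`, with mean root energy `∫ rootEnergy V_LJ dP ≤ e⋆`
(`e⋆ = ⨅_Q e_LJ(Q)` over periodic configurations).  Let `P = join m` for a probability measure `m` on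
laws, `m`-almost all of which are point-stationary probability laws with a property `𝓔` (think:
ergodicity).  Assume the energy lower bound of item 9229 (`hLB`, PROVED in the tree).  Then there is a
probability law `P'`, almost surely rooted `δ`-hard-core, point-stationary, with `𝓔`, with the
almost-sure properties `p₁`, `p₂`, with `P' S₃ = 0`, and with mean root energy `≤ e⋆`: every
point-stationary hard-core component has mean `≥ e⋆` (`hLB`), the components' means average to the
mean of `P` (`Measure.lintegral_join` on the clamped measurable root energy), so almost every component
has mean exactly `e⋆`. [folklore] -/
theorem exists_of_join (hLB : UnimodularEnergyLowerBound) {δ : ℝ} (hδ : 0 < δ)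
    {P : Measure (Measure (EuclideanSpace ℝ (Fin 3)))} [IsProbabilityMeasure P]
    (hcore : ∀ᵐ μ ∂P, IsRootedHardCore δ μ) {p₁ p₂ : Measure (EuclideanSpace ℝ (Fin 3)) → Prop} (h₁ : ∀ᵐ μ ∂P, p₁ μ)
    (h₂ : ∀ᵐ μ ∂P, p₂ μ) {S₃ : Set (Measure (EuclideanSpace ℝ (Fin 3)))} (h₃ : P S₃ = 0)
    (hen : ∫ μ, rootEnergy lennardJones μ ∂P ≤
      ⨅ Q : PeriodicConfiguration 3, Q.energyPerParticle lennardJones)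
    {m : Measure (Measure (Measure (EuclideanSpace ℝ (Fin 3))))} [IsProbabilityMeasure m] (hjoin : m.join = P)
    {𝓔 : Measure (Measure (EuclideanSpace ℝ (Fin 3))) → Prop}
    (hcomp : ∀ᵐ P' ∂m, IsProbabilityMeasure P' ∧ IsPointStationaryLaw P' ∧ 𝓔 P') :
    ∃ P' : Measure (Measure (EuclideanSpace ℝ (Fin 3))), IsProbabilityMeasure P' ∧ (∀ᵐ μ ∂P', IsRootedHardCore δ μ) ∧
      IsPointStationaryLaw P' ∧ 𝓔 P' ∧ (∀ᵐ μ ∂P', p₁ μ) ∧ (∀ᵐ μ ∂P', p₂ μ) ∧ P' S₃ = 0 ∧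
      ∫ μ, rootEnergy lennardJones μ ∂P' ≤
        ⨅ Q : PeriodicConfiguration 3, Q.energyPerParticle lennardJones := by
  set e : ℝ := ⨅ Q : PeriodicConfiguration 3, Q.energyPerParticle lennardJones with he_def
  -- null sets and almost-sure properties pass to almost every component
  have hcore' : ∀ᵐ P' ∂m, ∀ᵐ μ ∂P', IsRootedHardCore δ μ :=
    Measure.ae_ae_of_ae_join (by rw [hjoin]; exact hcore)
  have h₁' : ∀ᵐ P' ∂m, ∀ᵐ μ ∂P', p₁ μ := Measure.ae_ae_of_ae_join (by rw [hjoin]; exact h₁)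
  have h₂' : ∀ᵐ P' ∂m, ∀ᵐ μ ∂P', p₂ μ := Measure.ae_ae_of_ae_join (by rw [hjoin]; exact h₂)
  have h₃' : ∀ᵐ P' ∂m, P' S₃ = 0 := by
    have h : ∀ᵐ μ ∂m.join, μ ∉ S₃ := by rw [hjoin]; exact compl_mem_ae_iff.2 h₃
    exact (Measure.ae_ae_of_ae_join h).mono fun P' hP' => compl_mem_ae_iff.1 hP'
  -- the clamped measurable root energy and its nonnegative shift
  obtain ⟨B, hB0, G, hG, hGB, hGeq⟩ := exists_measurable_bounded_rootEnergy hδ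
  set f : Measure (EuclideanSpace ℝ (Fin 3)) → ℝ≥0∞ := fun μ => ENNReal.ofReal (G μ + B) with hf_def
  have hf : Measurable f := ENNReal.measurable_ofReal.comp (hG.add_const B)
  set L : Measure (Measure (EuclideanSpace ℝ (Fin 3))) → ℝ≥0∞ := fun Q => ∫⁻ μ, f μ ∂Q with hL_def
  have hL : Measurable L := Measure.measurable_lintegral hf
  -- mean root energy of a probability law with a.s. hard core, through `L`
  have hmean : ∀ (Q : Measure (Measure (EuclideanSpace ℝ (Fin 3)))), IsProbabilityMeasure Q →
      (∀ᵐ μ ∂Q, IsRootedHardCore δ μ) →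
      ∫ μ, rootEnergy lennardJones μ ∂Q = (L Q).toReal - B := by
    intro Q hQ hcQ
    rw [← integral_eq_toReal_lintegral_sub hG hGB]
    exact integral_congr_ae (hcQ.mono fun μ hμ => (hGeq μ hμ).symm)
  have hLfin : ∀ (Q : Measure (Measure (EuclideanSpace ℝ (Fin 3)))), IsProbabilityMeasure Q → L Q ≠ ∞ := fun Q hQ =>
    ((lintegral_ofReal_add_le (Q := Q) hGB).trans_lt ENNReal.ofReal_lt_top).ne
  -- the mean of `P` through `L`, and the sign of `e + B`
  have hPmean : ∫ μ, rootEnergy lennardJones μ ∂P = (L P).toReal - B := hmean P inferInstance hcore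
  have heB : 0 ≤ e + B := by
    by_contra hlt
    have hlt' : e + B < 0 := lt_of_not_ge hlt
    have h0 : 0 ≤ (L P).toReal := ENNReal.toReal_nonneg
    rw [hPmean] at hen
    linarith
  -- lower bound `e + B ≤ L` on almost every component (item 9229)
  have hlow : ∀ᵐ P' ∂m, ENNReal.ofReal (e + B) ≤ L P' := by
    filter_upwards [hcomp, hcore'] with P' hP' hcP'
    obtain ⟨hprob, hstat, -⟩ := hP'
    have hlb : e ≤ ∫ μ, rootEnergy lennardJones μ ∂P' := hLB δ hδ P' hprob hcP' hstat
    rw [hmean P' hprob hcP'] at hlb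
    rw [ENNReal.ofReal_le_iff_le_toReal (hLfin P' hprob)]
    linarith
  -- upper bound `∫ L dm = L P ≤ e + B`
  have hLP : L P = ∫⁻ P', L P' ∂m := by
    simp only [hL_def]
    rw [← hjoin]
    exact Measure.lintegral_join hf.aemeasurable
  have hup : ∫⁻ P', L P' ∂m ≤ ENNReal.ofReal (e + B) := by
    rw [← hLP, ENNReal.le_ofReal_iff_toReal_le (hLfin P inferInstance) heB]
    rw [hPmean] at hen
    linarith
  -- hence `L ≤ e + B` almost everywhere
  have hle : ∀ᵐ P' ∂m, L P' ≤ ENNReal.ofReal (e + B) := by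
    have hsub : ∫⁻ P', (L P' - ENNReal.ofReal (e + B)) ∂m = 0 := by
      rw [lintegral_sub measurable_const (by simp) hlow, lintegral_const, measure_univ, mul_one]
      exact tsub_eq_zero_of_le hup
    have hmeas : Measurable fun P' : Measure (Measure (EuclideanSpace ℝ (Fin 3))) => L P' - ENNReal.ofReal (e + B) :=
      hL.sub measurable_const
    rw [lintegral_eq_zero_iff hmeas] at hsub
    filter_upwards [hsub] with P' hP'
    simpa only [Pi.zero_apply, tsub_eq_zero_iff_le] using hP'
  -- pick a component with all the almost-sure properties
  obtain ⟨P', ⟨hprob, hstat, hE⟩, hcP', h1P', h2P', h3P', hleP'⟩ :=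
    (hcomp.and (hcore'.and (h₁'.and (h₂'.and (h₃'.and hle))))).exists
  refine ⟨P', hprob, hcP', hstat, hE, h1P', h2P', h3P', ?_⟩
  rw [hmean P' hprob hcP']
  have h := ENNReal.toReal_mono ENNReal.ofReal_ne_top hleP'
  rw [ENNReal.toReal_ofReal heB] at h
  linarith

/-! ### The registered stub from the ergodic decomposition -/

/-- **`S_ergodicReduction` from the ergodic decomposition of point-stationary hard-core laws.**  The
registered stub statement of `stub_ergodicReduction` (crux `AperiodicFrustratedLawGap`, skeleton
`dd3251ad731e`), VERBATIM, derived from two hypotheses: `hLB`, the energy lower bound of item 9229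
(`UnimodularEnergyLowerBound`, PROVED in the tree by
`Summit.AtomisticToContinuum.Crystallization.Theorems.unimodularEnergyLowerBound_proof`), and the one
remaining input `hdec`: every point-stationary probability law on rooted `δ`-hard-core configurations of
`ℝ³` is a mixture `join m` of point-stationary probability laws, `m`-almost all of which are trivial on
every measurable re-rooting-invariant set of configurations (ergodic decomposition in Palm /
mass-transport form: Kallenberg, *Foundations of Modern Probability* (3rd ed.) Prop. 10.24 and
Thm 10.26; Aldous–Lyons 2007 §4).  Given `hdec`, decompose the law `P` of the stub and apply
`exists_of_join` with the almost-sure clauses (texture matching, Nash, hard core) and the null periodic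
event: almost every ergodic component inherits them, and its mean root energy is `≤ e⋆` by `hLB` and
averaging. [folklore] -/
theorem ergodicReduction_of_decomposition (hLB : UnimodularEnergyLowerBound)
    (hdec : ∀ δ : ℝ, 0 < δ → ∀ P : MeasureTheory.Measure (MeasureTheory.Measure (EuclideanSpace ℝ (Fin 3))), MeasureTheory.IsProbabilityMeasure P → (∀ᵐ μ ∂P, Literature.Probability.Process.IsRootedHardCore δ μ) → Literature.Probability.Process.IsPointStationaryLaw P → ∃ m : MeasureTheory.Measure (MeasureTheory.Measure (MeasureTheory.Measure (EuclideanSpace ℝ (Fin 3)))), MeasureTheory.IsProbabilityMeasure m ∧ m.join = P ∧ ∀ᵐ P' ∂m, MeasureTheory.IsProbabilityMeasure P' ∧ Literature.Probability.Process.IsPointStationaryLaw P' ∧ (∀ A : Set (MeasureTheory.Measure (EuclideanSpace ℝ (Fin 3))), MeasurableSet A → (∀ μ : MeasureTheory.Measure (EuclideanSpace ℝ (Fin 3)), ∀ p : EuclideanSpace ℝ (Fin 3), μ {p} ≠ 0 → (μ ∈ A ↔ MeasureTheory.Measure.map (fun z : EuclideanSpace ℝ (Fin 3) => z - p) μ ∈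 A)) → P' A = 0 ∨ P' Aᶜ = 0)) :
    ∀ δ : ℝ, 0 < δ → ∀ P : MeasureTheory.Measure (MeasureTheory.Measure (EuclideanSpace ℝ (Fin 3))), let Gy : ℝ → (N : ℕ) → (Fin N → EuclideanSpace ℝ (Fin 3)) → Fin N → Prop := fun η N y j => let d : ℝ := sInf ((fun z => dist z (y (j : Fin N))) '' (Set.range (y) \ {(y (j : Fin N))})); let T : Set (EuclideanSpace ℝ (Fin 3)) := {z : EuclideanSpace ℝ (Fin 3) | z ∈ Set.range (y) ∧ z ≠ (y (j : Fin N)) ∧ dist z (y (j : Fin N)) < 13 / 10 * d}; ∃ A : EuclideanSpace ℝ (Fin 3) →ₗᵢ[ℝ] EuclideanSpace ℝ (Fin 3), (∃ e : ↥T ≃ ↥Literature.Geometry.DiscreteGeometry.fccKissingPattern, ∀ t : ↥T, dist (d⁻¹ • ((t : EuclideanSpace ℝ (Fin 3)) - (y (j : Fin N)))) (A ((e t : ↥Literature.Geometry.DiscreteGeometry.fccKissingPattern) : EuclideanSpace ℝ (Fin 3))) ≤ η) ∨ (∃ e : ↥T ≃ ↥Literature.Geometry.DiscreteGeometry.hcpKissingPattern,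 ∀ t : ↥T, dist (d⁻¹ • ((t : EuclideanSpace ℝ (Fin 3)) - (y (j : Fin N)))) (A ((e t : ↥Literature.Geometry.DiscreteGeometry.hcpKissingPattern) : EuclideanSpace ℝ (Fin 3))) ≤ η); let TexBall : (N : ℕ) → (Fin N → EuclideanSpace ℝ (Fin 3)) → Fin N → ℝ → ℝ → ℝ → ℝ → Prop := fun N y i R R₇ R₈ R₉ => (∀ a b : Fin N, a ≠ b → (7 : ℝ) / 10 ≤ dist (y a) (y b)) ∧ (∀ j : Fin N, dist (y j) (y i) ≤ R → ¬ Gy (1 / 20) N (y) j) ∧ (∀ j : Fin N, dist (y j) (y i) ≤ R → ¬ ((∀ j' : Fin N, dist (y j') (y j) ≤ R₇ → ¬ Gy (1 / 20) N (y) j') ∧ (∀ z : EuclideanSpace ℝ (Fin 3), dist z (y j) ≤ R₇ → ∃ k : Fin N, dist z (y k) ≤ 1) ∧ (∀ j' : Fin N, dist (y j') (y j) ≤ R₇ → (let d : ℝ := sInf ((fun z => dist z (y j')) '' (Set.range (y) \ {(y j')})); ∀ k : Fin N, y k ≠ y j' → dist (y k) (y j') < 27 / 20 * d → 5 ≤ Nat.card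 {m : Fin N // y m ≠ y j' ∧ dist (y m) (y j') < 27 / 20 * d ∧ y m ≠ y k ∧ dist (y m) (y k) < 27 / 20 * d})))) ∧ (∀ j : Fin N, dist (y j) (y i) ≤ R → ∃ k : Fin N, dist (y k) (y j) ≤ R₈ ∧ Gy (1 / 8) N (y) k) ∧ (∀ j : Fin N, dist (y j) (y i) ≤ R → ¬ ((∀ j' : Fin N, dist (y j') (y j) ≤ R₉ → ¬ Gy (1 / 20) N (y) j') ∧ (Nat.card {j' : Fin N // dist (y j') (y j) ≤ R₉ ∧ ¬ Gy (1 / 8) N (y) j'} : ℝ) ≤ 1 / 2 * (Nat.card {j' : Fin N // dist (y j') (y j) ≤ R₉} : ℝ) ∧ (∀ j' : Fin N, dist (y j') (y j) ≤ R₉ → ¬ Gy (1 / 8) N (y) j' → ¬ (let d : ℝ := sInf ((fun z => dist z (y j')) '' (Set.range (y) \ {(y j')})); ∀ k : Fin N, y k ≠ y j' → dist (y k) (y j') < 27 / 20 * d → 5 ≤ Nat.card {m : Fin N // y m ≠ y j' ∧ dist (y m) (y j') < 27 / 20 * d ∧ y m ≠ y k ∧ dist (y m) (y k) < 27 / 20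 * d})))); let Appr : MeasureTheory.Measure (EuclideanSpace ℝ (Fin 3)) → ℝ → ℝ → ℝ → Prop := fun μ R₇ R₈ R₉ => ∀ q : EuclideanSpace ℝ (Fin 3), μ {q} ≠ 0 → ∀ R ε : ℝ, 0 < ε → ∃ (N : ℕ) (y : Fin N → EuclideanSpace ℝ (Fin 3)) (i : Fin N), TexBall N y i R R₇ R₈ R₉ ∧ (∀ p : EuclideanSpace ℝ (Fin 3), μ {p} ≠ 0 → dist p q ≤ R → ∃ k : Fin N, dist (y k - y i) (p - q) ≤ ε) ∧ (∀ k : Fin N, dist (y k) (y i) ≤ R → ∃ p : EuclideanSpace ℝ (Fin 3), μ {p} ≠ 0 ∧ dist (y k - y i) (p - q) ≤ ε); MeasureTheory.IsProbabilityMeasure P → (∀ᵐ μ ∂P, Literature.Probability.Process.IsRootedHardCore δ μ) → Literature.Probability.Process.IsPointStationaryLaw P → (∃ R₇ R₈ R₉ : ℝ, ∀ᵐ μ ∂P, Appr μ R₇ R₈ R₉) → (∀ᵐ μ ∂P, ∀ p : EuclideanSpace ℝ (Fin 3), μ {p} ≠ 0 → ∀ y : EuclideanSpace ℝ (Fin 3),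 (∀ q : EuclideanSpace ℝ (Fin 3), μ {q} ≠ 0 → q ≠ p → y ≠ q) → ∑' q : {q : EuclideanSpace ℝ (Fin 3) // μ {q} ≠ 0 ∧ q ≠ p}, Literature.MathematicalPhysics.StatisticalMechanics.lennardJones (dist p (q : EuclideanSpace ℝ (Fin 3))) ≤ ∑' q : {q : EuclideanSpace ℝ (Fin 3) // μ {q} ≠ 0 ∧ q ≠ p}, Literature.MathematicalPhysics.StatisticalMechanics.lennardJones (dist y (q : EuclideanSpace ℝ (Fin 3)))) → P {μ : MeasureTheory.Measure (EuclideanSpace ℝ (Fin 3)) | ∃ Q : Literature.MathematicalPhysics.StatisticalMechanics.PeriodicConfiguration 3, ∃ t : EuclideanSpace ℝ (Fin 3), {p : EuclideanSpace ℝ (Fin 3) | μ {p} ≠ 0} = (fun s => s + t) '' Q.points} = 0 → (∫ μ, Literature.MathematicalPhysics.StatisticalMechanics.rootEnergy Literature.MathematicalPhysics.StatisticalMechanics.lennardJones μ ∂P) ≤ (⨅ Q : Literature.MathematicalPhysics.StatisticalMechanics.PeriodicConfiguration 3, Q.energyPerParticle Literature.MathematicalPhysics.StatisticalMechanics.lennardJones)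 → ∃ P' : MeasureTheory.Measure (MeasureTheory.Measure (EuclideanSpace ℝ (Fin 3))), MeasureTheory.IsProbabilityMeasure P' ∧ (∀ᵐ μ ∂P', Literature.Probability.Process.IsRootedHardCore δ μ) ∧ Literature.Probability.Process.IsPointStationaryLaw P' ∧ (∃ R₇ R₈ R₉ : ℝ, ∀ᵐ μ ∂P', Appr μ R₇ R₈ R₉) ∧ (∀ᵐ μ ∂P', ∀ p : EuclideanSpace ℝ (Fin 3), μ {p} ≠ 0 → ∀ y : EuclideanSpace ℝ (Fin 3), (∀ q : EuclideanSpace ℝ (Fin 3), μ {q} ≠ 0 → q ≠ p → y ≠ q) → ∑' q : {q : EuclideanSpace ℝ (Fin 3) // μ {q} ≠ 0 ∧ q ≠ p}, Literature.MathematicalPhysics.StatisticalMechanics.lennardJones (dist p (q : EuclideanSpace ℝ (Fin 3))) ≤ ∑' q : {q : EuclideanSpace ℝ (Fin 3) // μ {q} ≠ 0 ∧ q ≠ p}, Literature.MathematicalPhysics.StatisticalMechanics.lennardJones (dist y (q : EuclideanSpace ℝ (Fin 3)))) ∧ P' {μ : MeasureTheory.Measure (EuclideanSpace ℝ (Fin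 3)) | ∃ Q : Literature.MathematicalPhysics.StatisticalMechanics.PeriodicConfiguration 3, ∃ t : EuclideanSpace ℝ (Fin 3), {p : EuclideanSpace ℝ (Fin 3) | μ {p} ≠ 0} = (fun s => s + t) '' Q.points} = 0 ∧ (∫ μ, Literature.MathematicalPhysics.StatisticalMechanics.rootEnergy Literature.MathematicalPhysics.StatisticalMechanics.lennardJones μ ∂P') ≤ (⨅ Q : Literature.MathematicalPhysics.StatisticalMechanics.PeriodicConfiguration 3, Q.energyPerParticle Literature.MathematicalPhysics.StatisticalMechanics.lennardJones) ∧ (∀ A : Set (MeasureTheory.Measure (EuclideanSpace ℝ (Fin 3))), MeasurableSet A → (∀ μ : MeasureTheory.Measure (EuclideanSpace ℝ (Fin 3)), ∀ p : EuclideanSpace ℝ (Fin 3), μ {p} ≠ 0 → (μ ∈ A ↔ MeasureTheory.Measure.map (fun z : EuclideanSpace ℝ (Fin 3) => z - p) μ ∈ A)) → P' A = 0 ∨ P' Aᶜ = 0) := by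
  intro δ hδ P Gy TexBall Appr hP ha hb hd he h0 hen
  obtain ⟨R₇, R₈, R₉, hd'⟩ := hd
  obtain ⟨m, hm, hjoin, hcomp⟩ := hdec δ hδ P hP ha hb
  haveI := hP
  haveI := hm
  obtain ⟨P', hprob, hcP', hstat, herg, h1, h2, h3, henP'⟩ :=
    exists_of_join hLB hδ ha hd' he h0 hen hjoin hcomp
  exact ⟨P', hprob, hcP', hstat, ⟨R₇, R₈, R₉, h1⟩, h2, h3, henP', herg⟩

end Summit.AtomisticToContinuum.Crystallization.Theorems.FrustratedLawDichotomyErgodicReduction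

end
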